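import Summits.ABC.IUTFork.Joshi.TestGenuinePinsVacuityAllDegrees
import Summits.ABC.IUTFork.Joshi.TestGenuinePinsVacuityQuarticCell
import HarnessLib

/-!
# Branch E — Y-26 TWO-ROUTE CONCORDANCE IN KERNEL: the quartic cell is a COROLLARY of the all-degrees cut (E-ROW R-61)

Proof-only concordance file (abc-iut cell, D-0079 R-J «Joshi Y-discharge census», row Y-26, E-ROW R-61 = audit row A-51's
content in kernel; seat abc-iut-E-t24, gen 13; 0 definitions, no `Prop` fact, FACT rows used: none; count-neutral).  Two kernel
routes close the degree-`4` cell of the genuine-carrier pins at abc-iut-c312-7's `settingPrVolSharp`: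

* ★ p508929, abc-iut-E-t42's `Joshi/TestGenuinePinsVacuityQuarticCell.lean`: `not_pinnedRegions_settingPrVolSharp_of_finrank_eq_four`
  (`[F:ℚ] = 4 ⇒` KERNEL-EMPTY pins; Minkowski + Hunter–Pohst box + `√d ∈ F`), with its readings
  `finrank_eq_one_or_six_of_pinnedRegions_settingPrVolSharp` and `not_pinnedRegions_settingPrVolSharp_of_two_le_finrank_of_ne_six`;
* ★ p503388, abc-iut-f-045's `Joshi/TestGenuinePinsVacuityAllDegrees.lean`:
  `not_pinnedRegions_settingPrVolSharp_of_one_lt_finrank_unconditional` (`1 < [F:ℚ] ⇒` KERNEL-EMPTY pins; the `F(ζ₃)` cut) and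
  `finrank_eq_one_of_pinnedRegions_settingPrVolSharp` (`pinned ⇒ [F:ℚ] = 1`).

THIS FILE: at the COMMON FRAME (the `variable` block below is byte-identical to l.36–87 of BOTH source files — analytic logarithms,
every `X`, `ρ`, `qK`, column data, `Ψ`, ideles, column, `htq0`, `htq1`) each of E-t42's five theorems is exhibited as ONE application
of an f-045 theorem (`[F:ℚ] = 4 ⇒ 1 < [F:ℚ]`, resp. `Or.inl`), in the sharpest kernel form: E-t42's PROOF TERM is stated EQUAL to the
f-045 term (`rfl`, proof irrelevance).  Such an `Eq` elaborates only if the two DECLARATIONS conclude the SAME proposition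
binder-for-binder — a mismatch in the `htq0`/`htq1`/frame binders or in the `PinnedRegions`/`settingPrVolSharp` arguments would be a
type error at that line; there is none (the gate's statement-dedup independently reports the re-derived statements `≡` E-t42's).
So route E-t42 (quartic cell) is a COROLLARY of route f-045 (all degrees) at the same frame, and E-t42's `[F:ℚ] ≠ 6` binder is idle.

HONEST SCOPE: OUR interface's pins at OUR sharp real container under Dupuy–Hilado's typed (Ind2); a concordance of two of OUR kernel
routes, nothing about print's (xi-e)/(xi-f); locates / conditionally verifies; typed ≠ proved ≠ endorsed; no abc claim; no side
taken on any author (Mochizuki / Scholze–Stix / Joshi / Dupuy–Hilado). [claim: Mochizuki2012, status: disputed] [cite: DupuyHilado2025, §4.9]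
-/

noncomputable section

open Set Function NumberField IsDedekindDomain Metric
open scoped Pointwise Classical

namespace Summit.ABC.IUTFork.Joshi

open Thm311 Thm311.Real Cor312 Cor312Vol Literature.IUT.LogThetaLattice Literature.IUT.LogVolume
  Literature.IUT.HodgeTheaters Literature.NumberTheory.NumberFields
open Literature.NumberTheory.GaloisRepresentations.Ultrametric
open GenuinePinsResidual GenuinePinsDividingLine

variable {F : Type} [Field F] [NumberField F] (X : PilotData F)
  (M : Type) [Field M] [NumberField M]
  (archPk : ∀ (j : (thetaIndex X).Label) (vQ : (thetaIndex X).VQ), Set ((logShellsDH X (analyticLogv F)).Packet j vQ))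
  (archSub : ∀ (j : (thetaIndex X).Label) (v : (thetaIndex X).V),
    Set ((logShellsDH X (analyticLogv F)).Packet j ((thetaIndex X).over v)))
  (Ψ : ℤ → ∀ v : (thetaIndex X).V, v ∈ (thetaIndex X).Vbad → Set ((logShellsDH X (analyticLogv F)).StarPacket v))
  (act : ℤ → ∀ v : (thetaIndex X).V, v ∈ (thetaIndex X).Vbad →
    (logShellsDH X (analyticLogv F)).StarPacket v → Module.End ℚ ((logShellsDH X (analyticLogv F)).StarPacket v))
  (Mmod : ℤ → ∀ j : (thetaIndex X).LabelStar, Set ((logShellsDH X (analyticLogv F)).GlobalPacket j.1))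
  (region : ℤ → ∀ j : (thetaIndex X).LabelStar, FinDivisor M → ∀ vQ : (thetaIndex X).VQ,
    Set ((logShellsDH X (analyticLogv F)).Packet j.1 vQ))
  (frobAdm : ℤ → ℤ → ∀ (j : (thetaIndex X).Label) (vQ : (thetaIndex X).VQ),
    Set ((logShellsDH X (analyticLogv F)).Packet j vQ) → Prop)
  (frobLogvol : ℤ → ℤ → ∀ (j : (thetaIndex X).Label) (vQ : (thetaIndex X).VQ),
    Set ((logShellsDH X (analyticLogv F)).Packet j vQ) → ℝ)
  (frobΨ : ℤ → ℤ → ∀ v : (thetaIndex X).V, v ∈ (thetaIndex X).Vbad → Set ((logShellsDH X (analyticLogv F)).StarPacket v))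
  (frobMmod : ℤ → ℤ → ∀ j : (thetaIndex X).LabelStar, Set ((logShellsDH X (analyticLogv F)).GlobalPacket j.1))
  (unitImage : ℤ → ℤ → ℕ → ∀ (j : (thetaIndex X).Label) (vQ : (thetaIndex X).VQ),
    Set ((logShellsDH X (analyticLogv F)).Packet j vQ))
  (ballImage : ℤ → ℤ → ∀ (j : (thetaIndex X).Label) (vQ : (thetaIndex X).VQ),
    Set ((logShellsDH X (analyticLogv F)).Packet j vQ))
  (thetaDiv : ℤ → ℤ → LgpDivisor M (thetaIndex X).lstar)
  (n : ℤ) {HT : Type} {LogLink : HT → HT → Type} {IsFull : ∀ {s t : HT}, LogLink s t → Prop}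
  (lat : LGPGaussianLogThetaLattice LogLink IsFull)
  {Frd : Type} {IsoF : Frd → Frd → Type} {Ob : Frd → Type} {realify : Frd → Frd} {Strip : Type}
  {IsoS : Strip → Strip → Type} {Mv : ∀ v : (thetaIndex X).V, v ∈ (thetaIndex X).Vbad → Type}
  [∀ v h, Monoid (Mv v h)]
  (sig : GlobalLGPFrobenioidSignature (thetaIndex X).lstar (thetaIndex X).V (· ∈ (thetaIndex X).Vbad)
    Frd IsoF Ob realify Strip IsoS Mv)
  (split : SplittingMonoids Mv) {ObΔ : Type} {N : ∀ v : (thetaIndex X).V, v ∈ (thetaIndex X).Vbad → Type}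
  [∀ v h, Monoid (N v h)] (qData : QPilotData ObΔ N)
  (t : ∀ (pp : Nat.Primes) (_ : Fin X.lstar) (x : (thetaIndex X).Fibre (.inr pp)),
    haveI : Fact (pp : ℕ).Prime := ⟨pp.2⟩; kOf X pp.1 x)
  (tq : ∀ (pp : Nat.Primes) (x : (thetaIndex X).Fibre (.inr pp)), haveI : Fact (pp : ℕ).Prime := ⟨pp.2⟩; kOf X pp.1 x)
  (ρ : (∀ v : (thetaIndex X).V, v ∈ (thetaIndex X).Vbad → Set ((logShellsDH X (analyticLogv F)).StarPacket v)) →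
    ∀ (j : (thetaIndex X).Label) (vQ : (thetaIndex X).VQ), Set ((logShellsDH X (analyticLogv F)).Packet j vQ))
  (qK : ∀ v : (thetaIndex X).V, v ∈ (thetaIndex X).Vbad → Set ((logShellsDH X (analyticLogv F)).StarPacket v))
  (htq0 : ∀ pp x, tq pp x ≠ 0)
  (htq1 : ∀ (pp : Nat.Primes) (x : (thetaIndex X).Fibre (.inr pp)),
    haveI : Fact (pp : ℕ).Prime := ⟨pp.2⟩; placeOf X pp.1 x ∉ X.S → ‖tq pp x‖ = 1)

/-- **R-61 CONCORDANCE WITNESS (`PinnedRegions`, binders aligned by name, checked by the kernel)**: E-t42's quartic-cell proof term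
`not_pinnedRegions_settingPrVolSharp_of_finrank_eq_four … h4` (p508929) EQUALS abc-iut-f-045's all-degrees term
`not_pinnedRegions_settingPrVolSharp_of_one_lt_finrank_unconditional … (1 < 4)` (p503388) — i.e. both declarations conclude the same
proposition `¬ PinnedRegions (ofShells (logShellsDH X (analyticLogv F)) …) (settingPrVolSharp X … tq t htq0 htq1) ρ qK` at this
frame, and the quartic cell is ONE application of the all-degrees cut. [cite: DupuyHilado2025, §4.9] [claim: Mochizuki2012, status: disputed] -/
theorem quarticCell_twoRoute_concordance (h4 : Module.finrank ℚ F = 4) :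
    not_pinnedRegions_settingPrVolSharp_of_finrank_eq_four X M archPk archSub Ψ act Mmod region frobAdm frobLogvol frobΨ
        frobMmod unitImage ballImage thetaDiv n lat sig split qData t tq ρ qK htq0 htq1 h4 =
      not_pinnedRegions_settingPrVolSharp_of_one_lt_finrank_unconditional X M archPk archSub Ψ act Mmod region frobAdm frobLogvol
        frobΨ frobMmod unitImage ballImage thetaDiv n lat sig split qData t tq ρ qK htq0 htq1 (by omega) :=
  rfl

/-- The `PinnedRegions3` witness: E-t42's `not_pinnedRegions3_settingPrVolSharp_of_finrank_eq_four … h4` EQUALS f-045's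
`not_pinnedRegions3_settingPrVolSharp_of_one_lt_finrank_unconditional … (1 < 4)`. [claim: Mochizuki2012, status: disputed] -/
theorem quarticCell3_twoRoute_concordance (h4 : Module.finrank ℚ F = 4) :
    not_pinnedRegions3_settingPrVolSharp_of_finrank_eq_four X M archPk archSub Ψ act Mmod region frobAdm frobLogvol frobΨ
        frobMmod unitImage ballImage thetaDiv n lat sig split qData t tq ρ qK htq0 htq1 h4 =
      not_pinnedRegions3_settingPrVolSharp_of_one_lt_finrank_unconditional X M archPk archSub Ψ act Mmod region frobAdm frobLogvol
        frobΨ frobMmod unitImage ballImage thetaDiv n lat sig split qData t tq ρ qK htq0 htq1 (by omega) :=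
  rfl

/-- E-t42's sharpened degree cut `pinned ⇒ [F:ℚ] = 1 ∨ [F:ℚ] = 6` is a corollary too: its proof term EQUALS `Or.inl` of f-045's
`finrank_eq_one_of_pinnedRegions_settingPrVolSharp … hpin` (same hypothesis `hpin`, same frame). [claim: Mochizuki2012, status: disputed] -/
theorem finrankOneOrSix_twoRoute_concordance
    (hpin : Cor312Vol.PinnedRegions
      (LatticeSituation.ofShells (logShellsDH X (analyticLogv F)) M archPk archSub
        (summandPiecesPr X (logvAnalytic_analyticLogv (F := F))).Adm
        (summandPiecesPr X (logvAnalytic_analyticLogv (F := F))).logvol Ψ act Mmod region frobAdm frobLogvol frobΨ frobMmod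
        unitImage ballImage thetaDiv)
      (settingPrVolSharp X (logvAnalytic_analyticLogv (F := F)) M archPk archSub Ψ act Mmod region n lat sig split qData tq t
        htq0 htq1) ρ qK) :
    finrank_eq_one_or_six_of_pinnedRegions_settingPrVolSharp X M archPk archSub Ψ act Mmod region frobAdm frobLogvol frobΨ
        frobMmod unitImage ballImage thetaDiv n lat sig split qData t tq ρ qK htq0 htq1 hpin =
      Or.inl (finrank_eq_one_of_pinnedRegions_settingPrVolSharp X M archPk archSub Ψ act Mmod region frobAdm frobLogvol frobΨ
        frobMmod unitImage ballImage thetaDiv n lat sig split qData t tq ρ qK htq0 htq1 hpin) :=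
  rfl

/-- The `PinnedRegions3` reading: E-t42's `finrank_eq_one_or_six_of_pinnedRegions3_settingPrVolSharp … hpin` EQUALS `Or.inl` of
f-045's `finrank_eq_one_of_pinnedRegions3_settingPrVolSharp … hpin`. [claim: Mochizuki2012, status: disputed] -/
theorem finrankOneOrSix3_twoRoute_concordance
    (hpin : Cor312Vol.PinnedRegions3
      (LatticeSituation.ofShells (logShellsDH X (analyticLogv F)) M archPk archSub
        (summandPiecesPr X (logvAnalytic_analyticLogv (F := F))).Adm
        (summandPiecesPr X (logvAnalytic_analyticLogv (F := F))).logvol Ψ act Mmod region frobAdm frobLogvol frobΨ frobMmod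
        unitImage ballImage thetaDiv)
      (settingPrVolSharp X (logvAnalytic_analyticLogv (F := F)) M archPk archSub Ψ act Mmod region n lat sig split qData tq t
        htq0 htq1) ρ qK) :
    finrank_eq_one_or_six_of_pinnedRegions3_settingPrVolSharp X M archPk archSub Ψ act Mmod region frobAdm frobLogvol frobΨ
        frobMmod unitImage ballImage thetaDiv n lat sig split qData t tq ρ qK htq0 htq1 hpin =
      Or.inl (finrank_eq_one_of_pinnedRegions3_settingPrVolSharp X M archPk archSub Ψ act Mmod region frobAdm frobLogvol frobΨ
        frobMmod unitImage ballImage thetaDiv n lat sig split qData t tq ρ qK htq0 htq1 hpin) :=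
  rfl

/-- E-t42's `not_pinnedRegions_settingPrVolSharp_of_two_le_finrank_of_ne_six … h2 h6` EQUALS f-045's all-degrees term at `1 < [F:ℚ]`
(from `h2 : 2 ≤ [F:ℚ]` alone) — the `h6 : [F:ℚ] ≠ 6` binder is IDLE after p503388. [claim: Mochizuki2012, status: disputed] -/
theorem twoLeNeSix_twoRoute_concordance (h2 : 2 ≤ Module.finrank ℚ F) (h6 : Module.finrank ℚ F ≠ 6) :
    not_pinnedRegions_settingPrVolSharp_of_two_le_finrank_of_ne_six X M archPk archSub Ψ act Mmod region frobAdm frobLogvol frobΨ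
        frobMmod unitImage ballImage thetaDiv n lat sig split qData t tq ρ qK htq0 htq1 h2 h6 =
      not_pinnedRegions_settingPrVolSharp_of_one_lt_finrank_unconditional X M archPk archSub Ψ act Mmod region frobAdm frobLogvol
        frobΨ frobMmod unitImage ballImage thetaDiv n lat sig split qData t tq ρ qK htq0 htq1 (by omega) :=
  rfl

end Summit.ABC.IUTFork.Joshi

end
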